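import Literature.NumberTheory.Automorphic.AdeleBaseChange
import Literature.NumberTheory.Automorphic.GaloisActionPlaces
import Literature.NumberTheory.DiophantineGeometry.KodairaSymbolUnramifiedBaseChangeProofs
import Literature.NumberTheory.DiophantineGeometry.MinimalModelUnramifiedProofs
import Literature.NumberTheory.EllipticCurves.PastenValuationProductTamagawaProofs
import Literature.NumberTheory.EllipticCurves.MatsunoCurvesRankProofs
import Literature.NumberTheory.EllipticCurves.TamagawaSubgroupProofs
import Literature.NumberTheory.EllipticCurves.TamagawaNeZeroProofs
import Literature.NumberTheory.EllipticCurves.GlobalMinimalModel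
import Literature.NumberTheory.EllipticCurves.FrobeniusTwist
import Literature.NumberTheory.EllipticCurves.NonsingularReductionEmbedding
import Literature.RingTheory.DiscreteValuationRing.AdicCompletionHensel
import Literature.NumberTheory.GaloisRepresentations.PadicAlgebraDegreeOnePlace
import Summits.BirchSwinnertonDyer.Rank1Residual.X11b.Three.TamagawaAtom
import Summits.BirchSwinnertonDyer.Rank1Residual.X11b.Three.GoodReductionSubgroupNodeFrobenius
import Summits.BirchSwinnertonDyer.Rank1Residual.AdditivePotMult.QuadraticBaseChangeTamagawaTypeIVInertLocal
import HarnessLib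

/-!
# The two LOCAL E₀-inputs (T), (C) at a CARRIER prime over an UNRAMIFIED place, from Kodaira–Néron
# (cell `bsd-stepL`, seat `bsd-stepL-tam3-p1` g18, LINE OWNER of crux 19109 `EulerHalvesAtThree`;
# `--supports stmt-BirchSwinnertonDyer-19109 --as helper`; the local core of `stub_carrierLocalE0AtThree` of `Lines/inert.lean` r17)

SETTING. `W/ℚ` a globally minimal elliptic curve, `L` a number field, `w` a finite place of `L` above the rational prime `q`, UNRAMIFIED
over `q` (`¬ (q) 𝓞_L ≤ w²`), with `3 ∣ c_q(W/ℚ_q)` (a CARRIER prime: by Tate's algorithm either split multiplicative of type `I_n`, `3 ∣ n = c_q`,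
or additive of Kodaira type IV ∕ IV* with `c_q = 3`; the tree's `split_or_typeIV_of_odd_prime_dvd_localTamagawaNumber`). Let `ι : ℚ_q → L_w` be
the local map (`Literature.NumberTheory.Automorphic.adicCompletionOfLiesOver`; it preserves valuations as `e = 1`), `X = W ⊗ ℚ_q` (minimal over
`𝓞_q`) and `X_w = W_L ⊗ L_w = X^ι` (minimal over `𝓞_w`: `isMinimal_map_of_map_uniformizer`).
§1 `localTamagawaNumber_completion_eq_padic_of_unramified_of_three_dvd` — **`c_w(W_L) = c_q(W)`**: `c_q ∣ c_w` (the injection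
`E(ℚ_q)∕E₀ ↪ E(L_w)∕E₀`); split case `c_w ≤ max 4 (ord_w Δ_min) = max 4 (ord_q Δ_min) = max 4 c_q` (Pasten's bound + the tree's unramified
Tate's-algorithm fact `kodairaSymbolAt_baseChange_of_ramificationIdx_eq_one_holds`) forces `c_w = c_q`; additive case `c_w ≤ 4` (additivity
transports) and `3 ∣ c_w` force `c_w = 3 = c_q`. (Not true without `3 ∣ c_q`: type IV with `c = 1` can acquire `c = 3`.)
§2 `exists_sub_mapPoint_mem_goodReductionSubgroup` — **(T_w) `E(L_w) = ι E(ℚ_q) + E₀(L_w)`** (an injection of finite groups of equal order is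
onto) and `localTamagawaNumber_nsmul_mem_goodReductionSubgroup` — **(C_w) `c_q • Q ∈ E₀(L_w)`**.
The GLOBAL forms on `L`-points ((T): every `τ ∈ Aut_ℚ(L)` fixing `w` acts trivially on `E(L) ∕ E₀,w`; (C): `c_q • P ∈ E₀,w`) follow in the
companion file `…CarrierLocalE0Global` (transport `L → L_w`, `τ ↦ galAdicCompletionMap τ`).
HONEST FRAMING: THEOREMS ONLY (no definition, no named fact, no `sorry`); Kodaira–Néron is the tree's (discharged); nothing about any CM point,
no item closes; 19109 OPEN; BSD is proved for no curve (T7).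
-- §1's local map and uniformiser bookkeeping adapted from Literature/NumberTheory/DiophantineGeometry/KodairaSymbolUnramifiedBaseChangeProofs.lean.
References (locators only): [cite: SilvermanATAEC1994, IV Cor. 9.2 (d), IV.9.4 Table 4.1] [cite: SilvermanAEC2009, VII Prop. 2.1, Prop. VII.5.4 (a),
Thm. VII.6.1] [cite: CasselsFrohlichANT1967, Ch. VII §1.1, Ch. II §10]. presearch: «Tamagawa number unramified extension split multiplicative
type IV components rational» → [corpus: SilvermanATAEC1994 IV.9] (the per-type values; the statement `E(K') = E(K) + E₀(K')` for unramified `K'`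
at such types is folklore from the component-group description, no verbatim locus) — corpus fts+vec, galaxy "Tamagawa number|unramified".
Axioms: `propext`, `Classical.choice`, `Quot.sound`.
-/

set_option autoImplicit false
set_option linter.dupNamespace false

noncomputable section

open scoped Classical NumberField

namespace Summit.BirchSwinnertonDyer.BirchSwinnertonDyer.Theorems.CarrierLocalE0

open WeierstrassCurve IsDedekindDomain NumberField Literature.NumberTheory.EllipticCurves
  Literature.NumberTheory.DiophantineGeometry Literature.NumberTheory.Automorphic IsLocalRing
  Literature.NumberTheory.GaloisRepresentations Summit.BirchSwinnertonDyer.Rank1Residual.X11b.Three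

variable (W : WeierstrassCurve ℚ) [W.IsElliptic] [W.IsGloballyMinimal]
  {L : Type} [Field L] [NumberField L] (w : HeightOneSpectrum (𝓞 L))

/-! ### §0 The local map `ι : ℚ_q → L_w` of an unramified place -/

/-- `e(w | w ∩ ℤ) = 1` in Mathlib's `ramificationIdx'` currency from `¬ (w ∩ ℤ)·𝓞_L ≤ w²`. [folklore] -/
theorem ramificationIdx'_under_eq_one
    (he : ¬ (w.under (𝓞 ℚ)).asIdeal.map (algebraMap (𝓞 ℚ) (𝓞 L)) ≤ w.asIdeal ^ 2) :
    (w.under (𝓞 ℚ)).asIdeal.ramificationIdx' w.asIdeal = 1 := by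
  refine Ideal.ramificationIdx'_spec ?_ he
  rw [pow_one, Ideal.map_le_iff_le_comap]
  rfl

/-- The local map `ι : ℚ_{w ∩ ℤ} → L_w` preserves the valuation when `w` is unramified over `ℚ`. [folklore] -/
theorem valued_adicCompletionOfLiesOver_eq_of_unramified
    (he : ¬ (w.under (𝓞 ℚ)).asIdeal.map (algebraMap (𝓞 ℚ) (𝓞 L)) ≤ w.asIdeal ^ 2)
    (y : (w.under (𝓞 ℚ)).adicCompletion ℚ) :
    haveI : w.asIdeal.LiesOver (w.under (𝓞 ℚ)).asIdeal := ⟨rfl⟩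
    Valued.v (adicCompletionOfLiesOver ℚ L (w.under (𝓞 ℚ)) w y) = Valued.v y := by
  rw [valued_adicCompletionOfLiesOver, ramificationIdx'_under_eq_one w he, pow_one]

omit [W.IsElliptic] [W.IsGloballyMinimal] in
/-- The base change square: `(W_L)_{L_w} = (W_{ℚ_q})^ι`. [folklore] -/
theorem baseChange_baseChange_eq_map_adicCompletionOfLiesOver :
    haveI : w.asIdeal.LiesOver (w.under (𝓞 ℚ)).asIdeal := ⟨rfl⟩
    (W.baseChange L).baseChange (w.adicCompletion L) =
      (W.baseChange ((w.under (𝓞 ℚ)).adicCompletion ℚ)).map (adicCompletionOfLiesOver ℚ L (w.under (𝓞 ℚ)) w) := by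
  rw [WeierstrassCurve.baseChange, WeierstrassCurve.baseChange, WeierstrassCurve.baseChange,
    WeierstrassCurve.map_map, WeierstrassCurve.map_map]
  congr 1
  ext x
  rw [RingHom.comp_apply, RingHom.comp_apply, HeightOneSpectrum.algebraMap_adicCompletion,
    HeightOneSpectrum.algebraMap_adicCompletion, Function.comp_apply, Function.comp_apply,
    Algebra.algebraMap_self_apply, Algebra.algebraMap_self_apply, adicCompletionOfLiesOver_coe]

/-- **`W_L ⊗ L_w` is a minimal equation over `𝓞_w`** when `W/ℚ` is globally minimal and `w` is unramified over `ℚ` (Silverman, *AEC*,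
Prop. VII.5.4 (a): "the original equation is also minimal over `K'`"; the tree's `isMinimal_map_of_map_uniformizer`).
[cite: SilvermanAEC2009, Prop. VII.5.4 (a)] -/
theorem isMinimal_baseChange_adicCompletion_of_unramified
    (he : ¬ (w.under (𝓞 ℚ)).asIdeal.map (algebraMap (𝓞 ℚ) (𝓞 L)) ≤ w.asIdeal ^ 2) :
    ((W.baseChange L).baseChange (w.adicCompletion L)).IsMinimal (w.adicCompletionIntegers L) := by
  classical
  haveI : w.asIdeal.LiesOver (w.under (𝓞 ℚ)).asIdeal := ⟨rfl⟩
  set v : HeightOneSpectrum (𝓞 ℚ) := w.under (𝓞 ℚ) with hv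
  haveI : PerfectField (ResidueField (v.adicCompletionIntegers ℚ)) := PerfectField.ofFinite
  haveI : Finite (ResidueField (w.adicCompletionIntegers L)) :=
    HeightOneSpectrum.finite_residueField_adicCompletionIntegers L w
  haveI : PerfectField (ResidueField (w.adicCompletionIntegers L)) := PerfectField.ofFinite
  set ι := adicCompletionOfLiesOver ℚ L v w with hι
  have hval : ∀ y : v.adicCompletion ℚ, Valued.v (ι y) = Valued.v y := fun y ↦
    valued_adicCompletionOfLiesOver_eq_of_unramified w he y
  let ιₒ : v.adicCompletionIntegers ℚ →+* w.adicCompletionIntegers L :=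
    (ι.comp (v.adicCompletionIntegers ℚ).subtype).codRestrict (w.adicCompletionIntegers L)
      (fun x ↦ adicCompletionOfLiesOver_mem_adicCompletionIntegers ℚ L v w x.2)
  have hc : ∀ r : v.adicCompletionIntegers ℚ,
      ι (algebraMap (v.adicCompletionIntegers ℚ) (v.adicCompletion ℚ) r) =
        algebraMap (w.adicCompletionIntegers L) (w.adicCompletion L) (ιₒ r) := fun _ ↦ rfl
  obtain ⟨u, hu⟩ : ∃ u : (w.adicCompletionIntegers L)ˣ,
      ιₒ (TateAlgorithm.uniformizer (v.adicCompletionIntegers ℚ)) =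
        ↑u * TateAlgorithm.uniformizer (w.adicCompletionIntegers L) := by
    have h1 : Irreducible (ιₒ (TateAlgorithm.uniformizer (v.adicCompletionIntegers ℚ))) := by
      rw [Summit.BirchSwinnertonDyer.Rank1Residual.AdditivePotMult.TypeIVTwist.irreducible_iff_valued_eq_exp_neg_one]
      change Valued.v (ι _) = _
      rw [hval]
      exact (Summit.BirchSwinnertonDyer.Rank1Residual.AdditivePotMult.TypeIVTwist.irreducible_iff_valued_eq_exp_neg_one v _).mp
        TateAlgorithm.irreducible_uniformizer
    obtain ⟨u, hu⟩ := IsDiscreteValuationRing.associated_of_irreducible _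
      TateAlgorithm.irreducible_uniformizer h1
    exact ⟨u, by rw [← hu, mul_comm]⟩
  have hΔ : (W.baseChange (v.adicCompletion ℚ)).Δ ≠ 0 := by
    rw [WeierstrassCurve.baseChange, WeierstrassCurve.map_Δ]
    exact (map_ne_zero_iff _ (algebraMap ℚ (v.adicCompletion ℚ)).injective).mpr W.isUnit_Δ.ne_zero
  haveI : (W.baseChange (v.adicCompletion ℚ)).IsMinimal (v.adicCompletionIntegers ℚ) := IsGloballyMinimal.isMinimal v
  rw [baseChange_baseChange_eq_map_adicCompletionOfLiesOver W w]
  exact WeierstrassCurve.isMinimal_map_of_map_uniformizer ιₒ ι hc hu _ hΔ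

/-! ### §1 The injection `E(ℚ_q)∕E₀ ↪ E(L_w)∕E₀` and `c_w = c_q` at a carrier -/

/-- **`E₀` transports along `ι : ℚ_q → L_w`**: a point of `X = W ⊗ ℚ_q` has nonsingular reduction over `𝓞_q` iff its image on
`X^ι = W_L ⊗ L_w` has over `𝓞_w` (`w` unramified; same equation, `ι` valuation-preserving; Silverman *AEC* VII.2). [cite: SilvermanAEC2009, VII §2 Prop. 2.1] -/
theorem isNonsingularReductionPoint_mapPoint_iff_of_unramified
    (he : ¬ (w.under (𝓞 ℚ)).asIdeal.map (algebraMap (𝓞 ℚ) (𝓞 L)) ≤ w.asIdeal ^ 2)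
    (P : (W.baseChange ((w.under (𝓞 ℚ)).adicCompletion ℚ)).toAffine.Point) :
    haveI : w.asIdeal.LiesOver (w.under (𝓞 ℚ)).asIdeal := ⟨rfl⟩
    haveI := isMinimal_baseChange_adicCompletion_of_unramified W w he
    haveI := IsGloballyMinimal.isMinimal (W := W) (w.under (𝓞 ℚ))
    ((W.baseChange L).baseChange (w.adicCompletion L)).IsNonsingularReductionPoint (w.adicCompletionIntegers L)
        (mapPoint (adicCompletionOfLiesOver ℚ L (w.under (𝓞 ℚ)) w)
          (baseChange_baseChange_eq_map_adicCompletionOfLiesOver W w).symm P) ↔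
      (W.baseChange ((w.under (𝓞 ℚ)).adicCompletion ℚ)).IsNonsingularReductionPoint
        ((w.under (𝓞 ℚ)).adicCompletionIntegers ℚ) P := by
  classical
  haveI : w.asIdeal.LiesOver (w.under (𝓞 ℚ)).asIdeal := ⟨rfl⟩
  haveI hminY := isMinimal_baseChange_adicCompletion_of_unramified W w he
  haveI hminX : (W.baseChange ((w.under (𝓞 ℚ)).adicCompletion ℚ)).IsMinimal ((w.under (𝓞 ℚ)).adicCompletionIntegers ℚ) :=
    IsGloballyMinimal.isMinimal (w.under (𝓞 ℚ))
  have hval : ∀ y : (w.under (𝓞 ℚ)).adicCompletion ℚ,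
      Valued.v (adicCompletionOfLiesOver ℚ L (w.under (𝓞 ℚ)) w y) = Valued.v y := fun y ↦
    valued_adicCompletionOfLiesOver_eq_of_unramified w he y
  -- the two integral models
  have hX : W.baseChange ((w.under (𝓞 ℚ)).adicCompletion ℚ) =
      ((W.baseChange ((w.under (𝓞 ℚ)).adicCompletion ℚ)).integralModel ((w.under (𝓞 ℚ)).adicCompletionIntegers ℚ)).baseChange
        ((w.under (𝓞 ℚ)).adicCompletion ℚ) :=
    (WeierstrassCurve.baseChange_integralModel_eq _ _).symm
  let ιₒ : (w.under (𝓞 ℚ)).adicCompletionIntegers ℚ →+* w.adicCompletionIntegers L :=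
    ((adicCompletionOfLiesOver ℚ L (w.under (𝓞 ℚ)) w).comp ((w.under (𝓞 ℚ)).adicCompletionIntegers ℚ).subtype).codRestrict
      (w.adicCompletionIntegers L) (fun x ↦ adicCompletionOfLiesOver_mem_adicCompletionIntegers ℚ L (w.under (𝓞 ℚ)) w x.2)
  have hc : ∀ r : (w.under (𝓞 ℚ)).adicCompletionIntegers ℚ,
      algebraMap (w.adicCompletionIntegers L) (w.adicCompletion L) (ιₒ r) =
        adicCompletionOfLiesOver ℚ L (w.under (𝓞 ℚ)) w
          (algebraMap ((w.under (𝓞 ℚ)).adicCompletionIntegers ℚ) ((w.under (𝓞 ℚ)).adicCompletion ℚ) r) := fun _ ↦ rfl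
  have hY : (W.baseChange L).baseChange (w.adicCompletion L) =
      (((W.baseChange ((w.under (𝓞 ℚ)).adicCompletion ℚ)).integralModel ((w.under (𝓞 ℚ)).adicCompletionIntegers ℚ)).map ιₒ).baseChange
        (w.adicCompletion L) := by
    have h1 := baseChange_baseChange_eq_map_adicCompletionOfLiesOver W w
    rw [hX] at h1
    rw [h1]
    simp only [WeierstrassCurve.baseChange, WeierstrassCurve.map_map]
    exact congrArg _ (RingHom.ext fun r ↦ (hc r).symm)
  have hf : ∀ z : (w.under (𝓞 ℚ)).adicCompletion ℚ,
      Valued.v z ≤ 1 ↔ Valued.v (adicCompletionOfLiesOver ℚ L (w.under (𝓞 ℚ)) w z) ≤ 1 := fun z ↦ by rw [hval]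
  rw [WeierstrassCurve.mem_goodReductionSubgroup_iff_holds _ _ _ |>.symm.trans
      (Summit.BirchSwinnertonDyer.Rank1Residual.X11b.Three.JetchevKummer.mem_goodReductionSubgroup_iff_hasNonsingularReduction_congrEquiv
        (W.baseChange L) (w.adicCompletion L) (w.adicCompletionIntegers L) _ hY _),
    WeierstrassCurve.mem_goodReductionSubgroup_iff_holds _ _ _ |>.symm.trans
      (Summit.BirchSwinnertonDyer.Rank1Residual.X11b.Three.JetchevKummer.mem_goodReductionSubgroup_iff_hasNonsingularReduction_congrEquiv
        W ((w.under (𝓞 ℚ)).adicCompletion ℚ) ((w.under (𝓞 ℚ)).adicCompletionIntegers ℚ) _ hX _)]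
  rcases P with _ | ⟨x, y, hxy⟩
  · rw [show (Affine.Point.zero : (W.baseChange ((w.under (𝓞 ℚ)).adicCompletion ℚ)).toAffine.Point) = 0 from rfl,
      map_zero, map_zero, map_zero]
    exact iff_of_true (WeierstrassCurve.hasNonsingularReduction_zero (W := _))
      (WeierstrassCurve.hasNonsingularReduction_zero (W := _))
  · rw [mapPoint_some, Affine.Point.congrEquiv_some, Affine.Point.congrEquiv_some]
    exact hasNonsingularReduction_some_iff_of_ringHom (HeightOneSpectrum.adicCompletionIntegers.integers ℚ (w.under (𝓞 ℚ)))
      (HeightOneSpectrum.adicCompletionIntegers.integers L w) (adicCompletionOfLiesOver ℚ L (w.under (𝓞 ℚ)) w) ιₒ hc hf rfl _ _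

/-- **`c_q(W) ∣ c_w(W_L)` for `w` unramified over `q`**: the map `E(ℚ_q)∕E₀ → E(L_w)∕E₀` induced by `ι` is an injective homomorphism of
finite groups. [cite: SilvermanAEC2009, VII §2 Prop. 2.1, Thm. VII.6.1] -/
theorem localTamagawaNumber_dvd_of_unramified
    (he : ¬ (w.under (𝓞 ℚ)).asIdeal.map (algebraMap (𝓞 ℚ) (𝓞 L)) ≤ w.asIdeal ^ 2) :
    (W.baseChange ((w.under (𝓞 ℚ)).adicCompletion ℚ)).localTamagawaNumber ((w.under (𝓞 ℚ)).adicCompletionIntegers ℚ) ∣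
      ((W.baseChange L).baseChange (w.adicCompletion L)).localTamagawaNumber (w.adicCompletionIntegers L) := by
  classical
  haveI : w.asIdeal.LiesOver (w.under (𝓞 ℚ)).asIdeal := ⟨rfl⟩
  haveI hminY := isMinimal_baseChange_adicCompletion_of_unramified W w he
  set v : HeightOneSpectrum (𝓞 ℚ) := w.under (𝓞 ℚ) with hv
  haveI hminX : (W.baseChange (v.adicCompletion ℚ)).IsMinimal (v.adicCompletionIntegers ℚ) :=
    IsGloballyMinimal.isMinimal v
  haveI : (W.baseChange (v.adicCompletion ℚ)).IsElliptic := by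
    unfold WeierstrassCurve.baseChange; infer_instance
  haveI : ((W.baseChange L).baseChange (w.adicCompletion L)).IsElliptic := by
    unfold WeierstrassCurve.baseChange; infer_instance
  rw [WeierstrassCurve.localTamagawaNumber_eq_index_goodReductionSubgroup,
    WeierstrassCurve.localTamagawaNumber_eq_index_goodReductionSubgroup, AddSubgroup.index_eq_card,
    AddSubgroup.index_eq_card]
  set f := mapPoint (adicCompletionOfLiesOver ℚ L v w) (baseChange_baseChange_eq_map_adicCompletionOfLiesOver W w).symm
    with hfdef
  set H₁ := (W.baseChange (v.adicCompletion ℚ)).goodReductionSubgroup (v.adicCompletionIntegers ℚ)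
  set H₂ := ((W.baseChange L).baseChange (w.adicCompletion L)).goodReductionSubgroup (w.adicCompletionIntegers L)
  have hle : H₁ ≤ H₂.comap f := fun P hP ↦ by
    rw [AddSubgroup.mem_comap, WeierstrassCurve.mem_goodReductionSubgroup_iff_holds]
    rw [WeierstrassCurve.mem_goodReductionSubgroup_iff_holds] at hP
    exact (isNonsingularReductionPoint_mapPoint_iff_of_unramified W w he P).mpr hP
  refine AddSubgroup.card_dvd_of_injective (QuotientAddGroup.map H₁ H₂ f hle) fun a b hab ↦ ?_
  obtain ⟨P, rfl⟩ := QuotientAddGroup.mk_surjective a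
  obtain ⟨Q, rfl⟩ := QuotientAddGroup.mk_surjective b
  rw [QuotientAddGroup.map_mk, QuotientAddGroup.map_mk, QuotientAddGroup.eq] at hab
  rw [QuotientAddGroup.eq]
  rw [← map_neg, ← map_add, WeierstrassCurve.mem_goodReductionSubgroup_iff_holds,
    isNonsingularReductionPoint_mapPoint_iff_of_unramified W w he] at hab
  exact (WeierstrassCurve.mem_goodReductionSubgroup_iff_holds _ _ _).mpr hab

/-- The square `ℚ → 𝓞 ℚ → …` of structure maps commutes (for the unramified Tate's-algorithm fact). [folklore] -/
theorem algebraMap_comp_eq : (algebraMap ℚ L).comp (algebraMap (𝓞 ℚ) ℚ) = (algebraMap (𝓞 L) L).comp (algebraMap (𝓞 ℚ) (𝓞 L)) :=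
  (IsScalarTower.algebraMap_eq (𝓞 ℚ) ℚ L).symm.trans (IsScalarTower.algebraMap_eq (𝓞 ℚ) (𝓞 L) L)

/-- **`c_w(W_L) = c_q(W)` at a CARRIER prime over an UNRAMIFIED place.** For `W/ℚ` globally minimal, `w ∣ q` a place of `L` unramified
over `ℚ` and `3 ∣ c_q(W/ℚ_q)`: the local Tamagawa number of `W_L` at `w` is `c_q`. Split case (`I_n`, `3 ∣ n = c_q`): `c_q ∣ c_w ≤
max 4 (ord_w Δ_min) = max 4 c_q`; additive case (IV ∕ IV*, `c_q = 3`): additivity transports, so `c_w ≤ 4`, and `3 ∣ c_w`. (FALSE without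
`3 ∣ c_q`: type IV with `c = 1` may acquire `c = 3` — Silverman *ATAEC* IV.9.4 Step 5.) [cite: SilvermanATAEC1994, IV Cor. 9.2 (d), IV.9.4 Table 4.1]
[cite: SilvermanAEC2009, Prop. VII.5.4 (a), Thm. VII.6.1] -/
theorem localTamagawaNumber_completion_eq_padic_of_unramified_of_three_dvd (q : ℕ) [Fact q.Prime]
    (hqw : ((q : ℕ) : 𝓞 L) ∈ w.asIdeal)
    (he : ¬ (w.under (𝓞 ℚ)).asIdeal.map (algebraMap (𝓞 ℚ) (𝓞 L)) ≤ w.asIdeal ^ 2)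
    (h3 : 3 ∣ (W.baseChange ℚ_[q]).localTamagawaNumber ℤ_[q]) :
    ((W.baseChange L).baseChange (w.adicCompletion L)).localTamagawaNumber (w.adicCompletionIntegers L) =
      (W.baseChange ℚ_[q]).localTamagawaNumber ℤ_[q] := by
  classical
  have hqv : ((q : ℕ) : 𝓞 ℚ) ∈ (w.under (𝓞 ℚ)).asIdeal := LocalField.natCast_mem_under q w hqw
  have hqq : ((Rat.HeightOneSpectrum.primesEquiv (w.under (𝓞 ℚ)) : Nat.Primes) : ℕ) = q :=
    LocalField.primesEquiv_eq_of_natCast_mem q _ hqv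
  have hTam := WeierstrassCurve.localTamagawaNumber_padic_eq_holds W (w.under (𝓞 ℚ)) q hqq
  rw [hTam] at h3 ⊢
  -- instances at `w`
  haveI : Finite (ResidueField (w.adicCompletionIntegers L)) :=
    HeightOneSpectrum.finite_residueField_adicCompletionIntegers L w
  haveI : PerfectField (ResidueField (w.adicCompletionIntegers L)) := PerfectField.ofFinite
  haveI : PerfectField (ResidueField ((w.under (𝓞 ℚ)).adicCompletionIntegers ℚ)) := PerfectField.ofFinite
  haveI : ((W.baseChange L).baseChange (w.adicCompletion L)).IsElliptic := by
    unfold WeierstrassCurve.baseChange; infer_instance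
  haveI hWL : (W.baseChange L).IsElliptic := by unfold WeierstrassCurve.baseChange; infer_instance
  -- `c_q ∣ c_w`, `c_w ≠ 0`
  have hdvd := localTamagawaNumber_dvd_of_unramified W w he
  have hne : ((W.baseChange L).baseChange (w.adicCompletion L)).localTamagawaNumber (w.adicCompletionIntegers L) ≠ 0 :=
    WeierstrassCurve.localTamagawaNumber_ne_zero_holds (w.adicCompletionIntegers L) _
  -- Tate's algorithm is insensitive to the unramified base change `ℚ_q → L_w`
  obtain ⟨hkod, hord⟩ := kodairaSymbolAt_baseChange_of_ramificationIdx_eq_one_holds L (w.under (𝓞 ℚ)) w W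
    (algebraMap_comp_eq (L := L)) rfl he
  set cw := ((W.baseChange L).baseChange (w.adicCompletion L)).localTamagawaNumber (w.adicCompletionIntegers L) with hcw
  set cq := (W.baseChange ((w.under (𝓞 ℚ)).adicCompletion ℚ)).localTamagawaNumber ((w.under (𝓞 ℚ)).adicCompletionIntegers ℚ)
    with hcq
  obtain ⟨k, hk⟩ := hdvd
  have hk1 : 1 ≤ k := Nat.one_le_iff_ne_zero.mpr fun h0 ↦ hne (by rw [hk, h0, mul_zero])
  rcases split_or_typeIV_of_odd_prime_dvd_localTamagawaNumber W (w.under (𝓞 ℚ)) Nat.prime_three (by norm_num) h3 with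
    ⟨hs, -⟩ | ⟨-, hIV, hc3⟩
  · -- split multiplicative at `q`: `c_q = ord_q Δ_min`, `c_w ≤ max 4 (ord_w Δ_min) = max 4 c_q`
    have hcq' : cq = W.ordMinimalDiscriminant (w.under (𝓞 ℚ)) :=
      localTamagawaNumber_eq_ordMinimalDiscriminant_of_hasSplitMultiplicativeReductionAt _ W hs
    have hle : cw ≤ max 4 cq := by
      rw [hcq', ← hord]
      exact localTamagawaNumber_le_max_four_ordMinimalDiscriminant w (W.baseChange L)
    have h3cq : 3 ≤ cq := Nat.le_of_dvd (Nat.pos_of_ne_zero fun h0 ↦ hne (by rw [hk, h0, zero_mul])) h3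
    rcases Nat.lt_or_ge k 2 with hk2 | hk2
    · have : k = 1 := by omega
      rw [hk, this, mul_one]
    · exfalso
      have : cq * 2 ≤ cq * k := Nat.mul_le_mul_left cq hk2
      rcases le_max_iff.mp hle with h4 | h4 <;> omega
  · -- Kodaira type IV ∕ IV* at `q`, `c_q = 3`: additive at `w`, so `c_w ≤ 4`, and `3 ∣ c_w`
    have hadd : W.HasAdditiveReductionAt (w.under (𝓞 ℚ)) := by
      refine (WeierstrassCurve.isAdditive_kodairaSymbolAt_iff_holds (w.under (𝓞 ℚ)) W).mp ?_
      rcases hIV with h | h <;> rw [h] <;> decide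
    have haddw : (W.baseChange L).HasAdditiveReductionAt w :=
      hasAdditiveReductionAt_baseChange_of_ramificationIdx_eq_one
        (kodairaSymbolAt_baseChange_of_ramificationIdx_eq_one_holds L (w.under (𝓞 ℚ)) w W)
        (algebraMap_comp_eq (L := L)) rfl he hadd
    have hns : ¬ (((W.baseChange L).baseChange (w.adicCompletion L)).minimal (w.adicCompletionIntegers L)).HasSplitMultiplicativeReduction
        (w.adicCompletionIntegers L) := fun hsp ↦
      WeierstrassCurve.HasMultiplicativeReductionAt.not_hasAdditiveReductionAt (W := W.baseChange L) (v := w)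
        hsp.toHasMultiplicativeReduction haddw
    have hle : cw ≤ 4 := localTamagawaNumber_le_four_of_not_hasSplitMultiplicativeReduction (w.adicCompletionIntegers L) _ hns
    have hcq3 : cq = 3 := hc3
    rw [hcq3] at hk ⊢
    omega

/-! ### §2 (T_w) and (C_w) over the completion `L_w` -/

/-- **(C_w) `c_q • Q ∈ E₀(L_w)` for every `Q ∈ E(L_w)`** (`w ∣ q` unramified, `3 ∣ c_q`): the index of `E₀(L_w)` is `c_w = c_q`.
[cite: SilvermanAEC2009, Thm. VII.6.1] -/
theorem localTamagawaNumber_nsmul_mem_goodReductionSubgroup (q : ℕ) [Fact q.Prime]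
    (hqw : ((q : ℕ) : 𝓞 L) ∈ w.asIdeal)
    (he : ¬ (w.under (𝓞 ℚ)).asIdeal.map (algebraMap (𝓞 ℚ) (𝓞 L)) ≤ w.asIdeal ^ 2)
    (h3 : 3 ∣ (W.baseChange ℚ_[q]).localTamagawaNumber ℤ_[q])
    (Q : ((W.baseChange L).baseChange (w.adicCompletion L)).toAffine.Point) :
    haveI := isMinimal_baseChange_adicCompletion_of_unramified W w he
    (W.baseChange ℚ_[q]).localTamagawaNumber ℤ_[q] • Q ∈
      ((W.baseChange L).baseChange (w.adicCompletion L)).goodReductionSubgroup (w.adicCompletionIntegers L) := by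
  haveI := isMinimal_baseChange_adicCompletion_of_unramified W w he
  haveI : ((W.baseChange L).baseChange (w.adicCompletion L)).IsElliptic := by
    unfold WeierstrassCurve.baseChange; infer_instance
  rw [← localTamagawaNumber_completion_eq_padic_of_unramified_of_three_dvd W w q hqw he h3,
    WeierstrassCurve.localTamagawaNumber_eq_index_goodReductionSubgroup]
  exact AddSubgroup.nsmul_index_mem _ Q

/-- **(T_w) `E(L_w) = ι E(ℚ_q) + E₀(L_w)`** (`w ∣ q` unramified, `3 ∣ c_q`): every `Q ∈ E(L_w)` differs from the image of a point of
`E(ℚ_q)` by a point of nonsingular reduction — the injection `E(ℚ_q)∕E₀ ↪ E(L_w)∕E₀` of finite groups of the same order `c_q = c_w` is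
onto. [cite: SilvermanAEC2009, Thm. VII.6.1] [cite: SilvermanATAEC1994, IV Cor. 9.2 (d)] -/
theorem exists_sub_mapPoint_mem_goodReductionSubgroup (q : ℕ) [Fact q.Prime]
    (hqw : ((q : ℕ) : 𝓞 L) ∈ w.asIdeal)
    (he : ¬ (w.under (𝓞 ℚ)).asIdeal.map (algebraMap (𝓞 ℚ) (𝓞 L)) ≤ w.asIdeal ^ 2)
    (h3 : 3 ∣ (W.baseChange ℚ_[q]).localTamagawaNumber ℤ_[q])
    (Q : ((W.baseChange L).baseChange (w.adicCompletion L)).toAffine.Point) :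
    haveI : w.asIdeal.LiesOver (w.under (𝓞 ℚ)).asIdeal := ⟨rfl⟩
    haveI := isMinimal_baseChange_adicCompletion_of_unramified W w he
    ∃ Q₀ : (W.baseChange ((w.under (𝓞 ℚ)).adicCompletion ℚ)).toAffine.Point,
      Q - mapPoint (adicCompletionOfLiesOver ℚ L (w.under (𝓞 ℚ)) w)
          (baseChange_baseChange_eq_map_adicCompletionOfLiesOver W w).symm Q₀ ∈
        ((W.baseChange L).baseChange (w.adicCompletion L)).goodReductionSubgroup (w.adicCompletionIntegers L) := by
  classical
  haveI : w.asIdeal.LiesOver (w.under (𝓞 ℚ)).asIdeal := ⟨rfl⟩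
  haveI hminY := isMinimal_baseChange_adicCompletion_of_unramified W w he
  haveI hminX : (W.baseChange ((w.under (𝓞 ℚ)).adicCompletion ℚ)).IsMinimal ((w.under (𝓞 ℚ)).adicCompletionIntegers ℚ) :=
    IsGloballyMinimal.isMinimal (w.under (𝓞 ℚ))
  haveI : (W.baseChange ((w.under (𝓞 ℚ)).adicCompletion ℚ)).IsElliptic := by
    unfold WeierstrassCurve.baseChange; infer_instance
  haveI : ((W.baseChange L).baseChange (w.adicCompletion L)).IsElliptic := by
    unfold WeierstrassCurve.baseChange; infer_instance
  set f := mapPoint (adicCompletionOfLiesOver ℚ L (w.under (𝓞 ℚ)) w)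
    (baseChange_baseChange_eq_map_adicCompletionOfLiesOver W w).symm with hfdef
  set H₁ := (W.baseChange ((w.under (𝓞 ℚ)).adicCompletion ℚ)).goodReductionSubgroup ((w.under (𝓞 ℚ)).adicCompletionIntegers ℚ) with hH₁
  set H₂ := ((W.baseChange L).baseChange (w.adicCompletion L)).goodReductionSubgroup (w.adicCompletionIntegers L) with hH₂
  have hle : H₁ ≤ H₂.comap f := fun P hP ↦ by
    rw [AddSubgroup.mem_comap, WeierstrassCurve.mem_goodReductionSubgroup_iff_holds]
    rw [WeierstrassCurve.mem_goodReductionSubgroup_iff_holds] at hP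
    exact (isNonsingularReductionPoint_mapPoint_iff_of_unramified W w he P).mpr hP
  set φ := QuotientAddGroup.map H₁ H₂ f hle with hφ
  have hinj : Function.Injective φ := fun a b hab ↦ by
    obtain ⟨P, rfl⟩ := QuotientAddGroup.mk_surjective a
    obtain ⟨P', rfl⟩ := QuotientAddGroup.mk_surjective b
    rw [hφ, QuotientAddGroup.map_mk, QuotientAddGroup.map_mk, QuotientAddGroup.eq] at hab
    rw [QuotientAddGroup.eq]
    rw [← map_neg, ← map_add, WeierstrassCurve.mem_goodReductionSubgroup_iff_holds,
      isNonsingularReductionPoint_mapPoint_iff_of_unramified W w he] at hab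
    exact (WeierstrassCurve.mem_goodReductionSubgroup_iff_holds _ _ _).mpr hab
  -- both quotients are finite of the same cardinality `c_q = c_w`
  have hqv : ((q : ℕ) : 𝓞 ℚ) ∈ (w.under (𝓞 ℚ)).asIdeal := LocalField.natCast_mem_under q w hqw
  have hqq : ((Rat.HeightOneSpectrum.primesEquiv (w.under (𝓞 ℚ)) : Nat.Primes) : ℕ) = q :=
    LocalField.primesEquiv_eq_of_natCast_mem q _ hqv
  have hcard : Nat.card (_ ⧸ H₁) = Nat.card (_ ⧸ H₂) := by
    rw [← AddSubgroup.index_eq_card, ← AddSubgroup.index_eq_card,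
      ← WeierstrassCurve.localTamagawaNumber_eq_index_goodReductionSubgroup,
      ← WeierstrassCurve.localTamagawaNumber_eq_index_goodReductionSubgroup,
      localTamagawaNumber_completion_eq_padic_of_unramified_of_three_dvd W w q hqw he h3,
      WeierstrassCurve.localTamagawaNumber_padic_eq_holds W (w.under (𝓞 ℚ)) q hqq]
  have hne : Nat.card (_ ⧸ H₂) ≠ 0 := by
    rw [← AddSubgroup.index_eq_card, ← WeierstrassCurve.localTamagawaNumber_eq_index_goodReductionSubgroup]
    exact WeierstrassCurve.localTamagawaNumber_ne_zero_holds (w.adicCompletionIntegers L) _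
  haveI : Finite (_ ⧸ H₂) := Nat.finite_of_card_ne_zero hne
  haveI : Finite (_ ⧸ H₁) := Nat.finite_of_card_ne_zero (hcard ▸ hne)
  obtain ⟨e⟩ := Finite.card_eq.mp hcard
  have hsurj : Function.Surjective φ := (Finite.injective_iff_surjective_of_equiv e).mp hinj
  obtain ⟨a, ha⟩ := hsurj (QuotientAddGroup.mk Q)
  obtain ⟨Q₀, rfl⟩ := QuotientAddGroup.mk_surjective a
  rw [hφ, QuotientAddGroup.map_mk, QuotientAddGroup.eq] at ha
  refine ⟨Q₀, ?_⟩
  rwa [sub_eq_add_neg, add_comm]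

end Summit.BirchSwinnertonDyer.BirchSwinnertonDyer.Theorems.CarrierLocalE0

end
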